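import Literature.NumberTheory.Automorphic.CDTTheorem722ThreeFactsProofs
import Literature.NumberTheory.EllipticCurves.EisensteinNewformLevelRaising
import Literature.NumberTheory.EllipticCurves.NewformGaloisRepEulerFactors
import Literature.NumberTheory.EllipticCurves.NewformGaloisRepArtinConductor
import Literature.NumberTheory.EllipticCurves.CuspFormLFunctionLevelConductorProofs
import Literature.NumberTheory.EllipticCurves.CuspFormLFunctionLevelConductorCarayolProofs
import Literature.NumberTheory.EllipticCurves.NewformGaloisRepThm61OfHeckeAlgebraRepProofs
import Literature.NumberTheory.EllipticCurves.NewformGaloisRepPadicAlgClProofs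
import Literature.NumberTheory.GaloisRepresentations.FramedRepBaseChange
import Literature.NumberTheory.GaloisRepresentations.FramedRepEquivConj
import Literature.NumberTheory.EllipticCurves.TateModuleTwistNewformEulerFactorsProofs
import Literature.NumberTheory.EllipticCurves.NeronOggShafarevichProofs
import Literature.NumberTheory.EllipticCurves.InertiaInvariantsAdditiveProofs
import Literature.NumberTheory.EllipticCurves.IsogenyFrobeniusTraceProofs
import HarnessLib

/-!
# Stub ideation `stub_threeImpTwo` — ideator k = 1, generation 7 (FAMILY 1: recognise & import)

Companion of `STUB-IDEAS-stub_threeImpTwo-1.md` (gen 7).  S9 (BCDT Introduction (3) ⇒ (2)) is a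
composition of catalogued named facts; gens 3–6 of all three ideators kernel-checked every arrow.
Gen 7 MERGES the k1 architecture (`J(p) → R(p)`: the weight-two Jacobian leaf, Conrad App. 5.11/5.12,
Diamond–Shurman 9.5.3/9.5.4) with the k2 architecture (`SomeLevelPacket → S9` from Carayol (A),
Saito's `p = 2` leaf and the Steinberg corner) through ONE new Carayol-free seam:

* **H7 (NEW, M, `sorry` = the stub prover's item)** `hasGoodReductionAt_and_cuspCoeff_eq_of_realisation`:
  one irreducible realisation `ρ_g` of the rational newform `f₀` at `p'`, plus `a_q(f₀) = a_q(W)` off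
  a finite set, gives — at EVERY `q ∤ N p'`, with NO Carayol input — good reduction of `W` at `q`
  (Chebotarev + Brauer–Nesbitt `ρ_g ≅ V_{p'}W ⊗ ℚ̄` = gen-3 H2′ PROVED; unramifiedness transported by
  `isUnramifiedAt_of_equiv` / `isUnramifiedAt_baseChange_iff`; Néron–Ogg–Shafarevich
  `hasGoodReductionAt_iff_forall_rationalGaloisRepTate_eq_one neronOggShafarevich_holds`) and
  `a_q(f₀) = a_q(W)` (`hasFrobCharpolyAt_of_equiv`, `hasFrobCharpolyAt_baseChange`,
  `HasFrobCharpolyAt.unique`, `X`-coefficients).  The `q ∣ N` half of gen-3/5's L5 (which needs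
  `Carayol1986_eulerFactor`) is NOT needed on this road.
* **Seam (NEW, PROVED from H7)** `someLevelPacket_of_two_realisations : p₁ ≠ p₂ → R(p₁) → R(p₂) →
  SomeLevelPacket` (the `ℓ`-hole of the hypothesis is filled by the realisation at the other prime),
  hence `J(3) → J(5) → SomeLevelPacket` (k1 g6 H1–H3, verbatim, PROVED).
* **Closer**: with k2 g6's PROVED `stub_threeImpTwo_of_packet_leaves ∘
  steinbergSignPacket_of_newform0SteinbergCoinvariants` (type `PacketLeavesCloser` below; crux-dir
  companions are not importable, so it enters BY NAME as a hypothesis) the VERBATIM stub follows from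
  the minimal leaf set {`J(3)`, `J(5)`, `Carayol1986_artinConductorExponent`, Saito-at-2 (∀ curves),
  `Newform0SteinbergCoinvariants`} — no `Carayol1986_eulerFactor`, no `eichlerShimuraConstruction`,
  no `IsNewformOf.level_eq_conductorNorm`, no `Hida2000_thm326_exists_galoisRep`.

NO `sorry` (H7 PROVED from the transcribed gen-3 H2′ and tree lemmas).
-/

noncomputable section

open scoped NumberField Polynomial MatrixGroups ModularForm
open NumberField IsDedekindDomain IsDedekindDomain.HeightOneSpectrum Field Polynomial
open CongruenceSubgroup Rat.HeightOneSpectrum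
open Literature.NumberTheory.EllipticCurves
open Literature.NumberTheory.EllipticCurves.ModularForms
open Literature.NumberTheory.EllipticCurves.ModularForms.DeligneSerre1974
open Literature.NumberTheory.Automorphic
open Literature.NumberTheory.Automorphic.BCDT
open Literature.NumberTheory.GaloisRepresentations
open WeierstrassCurve

namespace Summit.ABC.ABC.Cruxes.FreyModularity.Sketch.StubIdeasThreeImpTwo1G7

/-! ## §0 The stub and the leaf currencies (verbatim from k1 g6 / k2 g6) -/

/-- The registered stub's type, character for character (`Lines/Sketch.lean`, `stub_threeImpTwo`). -/
def SigS9 : Prop :=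
  ∀ (W : WeierstrassCurve ℚ) [W.IsElliptic] [NeZero (W.conductorNorm ℤ)] (ℓ : ℕ) [Fact ℓ.Prime],
    W.IsModularGaloisRepTate ℓ → BCDT.IsModular W

example : SigS9 = (∀ (W : WeierstrassCurve ℚ) [W.IsElliptic] [NeZero (W.conductorNorm ℤ)] (ℓ : ℕ)
    [Fact ℓ.Prime], W.IsModularGaloisRepTate ℓ → BCDT.IsModular W) := rfl

/-- **`R(p)`** (verbatim k1 gens 5–6): realisation of RATIONAL weight-two `Γ₀`-newforms at the FIXED
prime `p`, in Carayol's currency. -/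
def RealisationAt (p : ℕ) [Fact p.Prime] : Prop :=
  ∀ {N : ℕ} [NeZero N] (f₀ : CuspForm (Gamma0 N) 2), IsNewform0 f₀ →
    (∀ n : ℕ, ∃ z : ℤ, cuspCoeff f₀ n = z) → ∀ ι : PadicAlgCl p ≃+* ℂ,
      ∃ ρ : FramedGaloisRep ℚ (PadicAlgCl p) 2,
        IsGaloisRepOfNewform1 (liftToGamma1 N 2 f₀)
          ((ι.symm : ℂ →+* PadicAlgCl p).comp (algebraMap (coeffCharField (liftToGamma1 N 2 f₀)) ℂ))
          {q | q ∣ N * p} ρ ∧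
        ρ.toGaloisRep.IsIrreducible

/-- **`J(p)`** (verbatim k1 g6): the weight-two Jacobian leaf — for every level `N ≥ 1` the framed
representation over the `p`-adic Hecke algebra of `S₂(Γ₁(N))` exists (Conrad Lemma 5.11 / Thm. 5.12,
Diamond–Shurman Lemma 9.5.3 / Thm. 9.5.4), in the tree's structure `DeligneHeckeRep`. -/
def JacobianLeafAt (p : ℕ) [Fact p.Prime] : Prop :=
  ∀ (N : ℕ) [NeZero N], Nonempty (DeligneHeckeRep p N 2)

/-- **`SomeLevelPacket`** (verbatim k2 g6 :1446): a modular `ρ_{W,ℓ}` yields a `Γ₀`-newform at SOME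
level `N` carrying `a_p(W)` for EVERY `p ∤ N` (hole at `ℓ` filled) with `W` good off `N`. -/
def SomeLevelPacket : Prop :=
  ∀ (W : WeierstrassCurve ℚ) [W.IsElliptic] (ℓ : ℕ) [Fact ℓ.Prime], W.IsModularGaloisRepTate ℓ →
    ∃ (N : ℕ) (_ : NeZero N) (f₀ : CuspForm (Gamma0 N) 2), IsNewform0 f₀ ∧
      (∀ v : HeightOneSpectrum (𝓞 ℚ), ¬ ((primesEquiv v : ℕ) ∣ N) → W.HasGoodReductionAt v) ∧
      ∀ p : ℕ, p.Prime → ¬ p ∣ N → cuspCoeff f₀ p = (W.LFunction p : ℂ)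

/-- **`Newform0SteinbergCoinvariants`** (verbatim k2 g6 :546): the Steinberg corner of Carayol's
local–global compatibility — weight `2`, trivial character, places `ℓ ∥ N`, read on inertia
coinvariants (Deligne–Rapoport 1973 / Langlands 1973; Darmon–Diamond–Taylor Thm. 3.1 (e), first case).
Binder-for-binder the instance `k = 2`, `g = liftToGamma1 N 2 f₀`, `ℓ ∣ N`, `¬ ℓ² ∣ N` of
`Carayol1986_eulerFactor` (k2 g6 :602 PROVES `Carayol1986_eulerFactor →` this).
[cite: DarmonDiamondTaylor1995, Thm. 3.1 (e) (p. 86)] [cite: CarayolASENS1986, Thm. (A)] -/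
def Newform0SteinbergCoinvariants : Prop :=
  ∀ {N : ℕ} [NeZero N] (f₀ : CuspForm (Gamma0 N) 2), IsNewform0 f₀ →
    ∀ (p : ℕ) [Fact p.Prime] (ι : PadicAlgCl p ≃+* ℂ) (ρ : FramedGaloisRep ℚ (PadicAlgCl p) 2),
      IsGaloisRepOfNewform1 (liftToGamma1 N 2 f₀)
        ((ι.symm : ℂ →+* PadicAlgCl p).comp (algebraMap (coeffCharField (liftToGamma1 N 2 f₀)) ℂ))
          {q | q ∣ N * p} ρ →
      ρ.toGaloisRep.IsIrreducible →
    ∀ ℓ : ℕ, ℓ.Prime → ℓ ≠ p → ℓ ∣ N → ¬ ℓ ^ 2 ∣ N →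
    ∀ w : HeightOneSpectrum (𝓞 ℚ), (ℓ : 𝓞 ℚ) ∈ w.asIdeal → ∀ 𝔔 ∈ w.primesAbove,
    ∀ σ : 𝔔.decompositionSubgroup (absoluteGaloisGroup ℚ),
      IsArithFrobAt (𝓞 ℚ) (σ : absoluteGaloisGroup ℚ) 𝔔 →
      (ρ.toGaloisRep.toInertiaCoinvariants 𝔔 σ).charpoly.reverse =
        1 - C (ι.symm (cuspCoeff (liftToGamma1 N 2 f₀) ℓ)) * X +
          C (ι.symm ((nebentypus (liftToGamma1 N 2 f₀) (ℓ : ZMod N) : ℂ) *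
            (ℓ : ℂ) ^ ((2 : ℤ) - 1))) * X ^ 2

/-! ## §1 `J(p) → R(p)` (k1 g6 H1, H2, H3 — verbatim, PROVED) -/

/-- **H1 (XS, PROVED)** — Conrad Cor. 5.15 per level, any coefficient field (k1 g6, verbatim). -/
theorem isGaloisRepOfNewform1_of_deligneHeckeRep {ℓ : ℕ} [Fact ℓ.Prime] {M : ℕ} [NeZero M]
    {k : ℤ} (D : DeligneHeckeRep ℓ M k) {g : CuspForm (Gamma1 M) k} (hg : IsNewform1 g)
    (E : Type) [Field E] [Algebra ℚ_[ℓ] E] [TopologicalSpace E] [ContinuousAdd E]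
    [ContinuousSMul ℚ_[ℓ] E] (ι : coeffCharField g →+* E) :
    ∃ ρ : FramedGaloisRep ℚ E 2, IsGaloisRepOfNewform1 g ι {p | p ∣ M * ℓ} ρ := by
  have hφc : Continuous
      (PadicHeckeAlgebra.lift ℓ (ι.comp hg.eigencharacterK) : PadicHeckeAlgebra ℓ M k →+* E) :=
    PadicHeckeAlgebra.continuous_lift ℓ (ι.comp hg.eigencharacterK)
  refine ⟨FramedRep.baseChange _ hφc D.ρ, fun v hv ↦ ⟨?_, ?_⟩⟩
  · intro 𝔓 h𝔓 σ hσ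
    rw [FramedRep.baseChange_apply, D.isUnramifiedAt v hv 𝔓 h𝔓 σ hσ, map_one]
  · have hq : ¬ ((primesEquiv v : Nat.Primes) : ℕ) ∣ M := fun h ↦ hv (dvd_mul_of_dvd_left h ℓ)
    have h := FramedGaloisRep.hasFrobCharpolyAt_baseChange _ hφc (D.hasFrobCharpolyAt v hv)
    rwa [hg.map_frobPoly_eigencharacter ℓ ι (primesEquiv v) hq] at h

/-- **H2 (S, PROVED)** — `J`-currency to Carayol's currency with irreducibility (k1 g6, verbatim):
place `v ∣ p` of `K_g` cut out by `ι₀⁻¹ ∘ (K_g ⊆ ℂ)`, H1 at `K_{g,v}`, Ribet (2.3) + oddness, base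
change to `ℚ̄_p`. -/
theorem exists_padicAlgClRep_of_deligneHeckeRep {p : ℕ} [Fact p.Prime] {N : ℕ} [NeZero N]
    {k : ℤ} (D : DeligneHeckeRep p N k) {g : CuspForm (Gamma1 N) k} (hk : 2 ≤ k)
    (hg : IsNewform1 g) (ι₀ : PadicAlgCl p ≃+* ℂ) :
    ∃ ρ : FramedGaloisRep ℚ (PadicAlgCl p) 2,
      IsGaloisRepOfNewform1 g
        ((ι₀.symm : ℂ →+* PadicAlgCl p).comp (algebraMap (coeffCharField g) ℂ)) {q | q ∣ N * p} ρ ∧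
      ρ.toGaloisRep.IsIrreducible := by
  classical
  haveI : FiniteDimensional ℚ (coeffField g) :=
    (IsNewform1.finiteDimensional_coeffField_of_span_integralLattice1
      (DeligneSerre1974_span_integralLattice1_holds N k)) hg
  haveI : FiniteDimensional ℚ (coeffCharField g) :=
    DeligneSerre1974.finiteDimensional_coeffCharField g
  haveI : NumberField (coeffCharField g) := NumberField.mk
  set j : coeffCharField g →+* PadicAlgCl p :=
    (ι₀.symm : ℂ →+* PadicAlgCl p).comp (algebraMap (coeffCharField g) ℂ) with hjdef
  obtain ⟨v, hpv, hjv⟩ := exists_heightOneSpectrum_of_ringHom_padicAlgCl j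
  obtain ⟨φ, hφc, hφj⟩ := exists_continuous_ringHom_adicCompletion_padicAlgCl j v hpv hjv
  have hφcomp : φ.comp (algebraMap (coeffCharField g) (v.adicCompletion (coeffCharField g))) = j :=
    RingHom.ext hφj
  letI := Literature.NumberTheory.GaloisRepresentations.LocalField.adicCompletionPadicAlgebra v p hpv
  haveI := finiteDimensional_padic_adicCompletion v p hpv
  haveI := isModuleTopology_padic_adicCompletion v p hpv
  haveI : ContinuousSMul ℚ_[p] (v.adicCompletion (coeffCharField g)) :=
    continuousSMul_padic_adicCompletion v p hpv
  obtain ⟨ρ, hρg⟩ := isGaloisRepOfNewform1_of_deligneHeckeRep D hg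
    (v.adicCompletion (coeffCharField g))
    (algebraMap (coeffCharField g) (v.adicCompletion (coeffCharField g)))
  have habs : FramedRep.IsAbsolutelyIrreducible ρ :=
    Ribet1977.isAbsolutelyIrreducible_of_thm23 Ribet1977.thm23_isIrreducible_holds hg (by omega) hρg
  refine ⟨FramedRep.baseChange φ hφc ρ, ?_, ?_⟩
  · intro w hw
    obtain ⟨hur, hchar⟩ := hρg w hw
    refine ⟨(FramedGaloisRep.isUnramifiedAt_baseChange_iff φ hφc φ.injective w ρ).mpr hur, ?_⟩
    have h := FramedGaloisRep.hasFrobCharpolyAt_baseChange φ hφc hchar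
    rwa [Polynomial.map_map, hφcomp] at h
  · exact habs (PadicAlgCl p) φ

/-- **H3 (XS, PROVED): `J(p) → R(p)`** (k1 g6, verbatim). -/
theorem realisationAt_of_jacobianLeafAt {p : ℕ} [Fact p.Prime] (H : JacobianLeafAt p) :
    RealisationAt p := by
  intro N _ f₀ hf₀ _ ι
  obtain ⟨D⟩ := H N
  exact exists_padicAlgClRep_of_deligneHeckeRep D le_rfl
    ((isNewform1_liftToGamma1_iff_holds (N := N) (k := 2) f₀).mpr hf₀) ι

/-! ## §2 NEW (gen 7): the Carayol-free transport at the unramified places -/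

/-- The `X`-coefficient of `X² - a X + b` is `-a` (gen-3 helper, verbatim). [folklore] -/
theorem coeff_one_X_sq_sub_C_mul_X_add_C' {S : Type*} [CommRing S] (a b : S) :
    (Polynomial.X ^ 2 - Polynomial.C a * Polynomial.X + Polynomial.C b).coeff 1 = -a := by
  simp [Polynomial.coeff_X_pow, Polynomial.coeff_C]

/-- **H7a = gen-3 H2′ (PROVED there; verbatim)** — recognition with `ρ_g` as INPUT — the body of H2 after its first line: any irreducible
`ρ_g` attached to the lift of `f₀` off `N p'` is isomorphic to `V_{p'}(E) ⊗ ℚ̄_{p'}` as soon as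
`a_p(f₀) = a_p(E)` off a finite set (`nonempty_equiv_twist_of_isGaloisRepOfNewform1` at `ψ = 1`).
PROVED. -/
theorem H2'_equiv_of_isGaloisRepOfNewform1
    (W : WeierstrassCurve ℚ) [W.IsElliptic] {N : ℕ} [NeZero N] (f₀ : CuspForm (Gamma0 N) 2)
    (hf₀ : IsNewform0 f₀) {T₀ : ℕ} (hT₀ : T₀ ≠ 0)
    (hfp : ∀ p : ℕ, p.Prime → ¬ p ∣ T₀ → cuspCoeff f₀ p = (W.LFunction p : ℂ))
    (p' : ℕ) [Fact p'.Prime] (ι : PadicAlgCl p' ≃+* ℂ) (VQ : FramedGaloisRep ℚ ℚ_[p'] 2)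
    (hV : ∀ v : HeightOneSpectrum (𝓞 ℚ), (p' : 𝓞 ℚ) ∉ v.asIdeal → W.HasGoodReductionAt v →
      FramedGaloisRep.IsUnramifiedAt v VQ ∧
        FramedGaloisRep.HasFrobCharpolyAt v
          (X ^ 2 - C ((W.LFunction (primesEquiv v : ℕ) : ℤ) : ℚ_[p']) * X +
            C ((primesEquiv v : ℕ) : ℚ_[p'])) VQ)
    (ρg : FramedGaloisRep ℚ (PadicAlgCl p') 2)
    (hρg : IsGaloisRepOfNewform1 (liftToGamma1 N 2 f₀)
      ((ι.symm : ℂ →+* PadicAlgCl p').comp (algebraMap (coeffCharField (liftToGamma1 N 2 f₀)) ℂ))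
      {q | q ∣ N * p'} ρg)
    (hirr : ρg.toGaloisRep.IsIrreducible) :
    Nonempty (ContinuousRep.Equiv ρg.toGaloisRep
      (FramedGaloisRep.toGaloisRep
        (VQ.baseChange (algebraMap ℚ_[p'] (PadicAlgCl p')) (continuous_algebraMap_padicAlgCl p')))) := by
  classical
  have hf0 : f₀ ≠ 0 := IsNormalized.ne_zero hf₀.2.2
  have hg : ∀ p : ℕ, p.Prime → ¬ p ∣ T₀ * N →
      cuspCoeff (liftToGamma1 N 2 f₀) p = (fun _ : ℕ ↦ (1 : ℂ)) p * (W.LFunction p : ℂ) ∧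
        (nebentypus (liftToGamma1 N 2 f₀) (p : ZMod N) : ℂ) = (fun _ : ℕ ↦ (1 : ℂ)) p ^ 2 := by
    intro p hp hpT
    have hpT₀ : ¬ p ∣ T₀ := fun h ↦ hpT (dvd_mul_of_dvd_left h _)
    have hpN : ¬ p ∣ N := fun h ↦ hpT (dvd_mul_of_dvd_right h _)
    refine ⟨?_, ?_⟩
    · rw [one_mul, ← hfp p hp hpT₀]
      rw [cuspCoeff, cuspCoeff, coe_liftToGamma1_holds N 2 f₀]
    · rw [nebentypus_liftToGamma1_holds (N := N) (k := 2) hf0, one_pow]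
      have hu : IsUnit (p : ZMod N) :=
        (ZMod.isUnit_iff_coprime p N).mpr (hp.coprime_iff_not_dvd.mpr hpN)
      rw [MulChar.one_apply hu]
  have hψI : ∀ v : HeightOneSpectrum (𝓞 ℚ), ¬ ((primesEquiv v : Nat.Primes) : ℕ) ∣ 1 →
      ∀ 𝔓 ∈ v.primesAbove, ∀ σ ∈ 𝔓.inertia (absoluteGaloisGroup ℚ),
        (1 : absoluteGaloisGroup ℚ →ₜ* (PadicAlgCl p')ˣ) σ = 1 := fun _ _ _ _ _ _ ↦ rfl
  have hψF : ∀ v : HeightOneSpectrum (𝓞 ℚ), ¬ ((primesEquiv v : Nat.Primes) : ℕ) ∣ 1 →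
      ∀ 𝔓 ∈ v.primesAbove, ∀ σ : absoluteGaloisGroup ℚ, IsArithFrobAt (𝓞 ℚ) σ 𝔓 →
        ((1 : absoluteGaloisGroup ℚ →ₜ* (PadicAlgCl p')ˣ) σ : PadicAlgCl p') =
          ι.symm ((fun _ : ℕ ↦ (1 : ℂ)) (primesEquiv v : ℕ)) := by
    intros; simp
  obtain ⟨e⟩ := nonempty_equiv_twist_of_isGaloisRepOfNewform1 W p' ι VQ hV 1 (fun _ ↦ (1 : ℂ)) 1
    hψI hψF (liftToGamma1 N 2 f₀) (mul_ne_zero hT₀ (NeZero.ne N)) hg ρg hρg hirr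
  rw [FramedRep.twist_one] at e
  exact ⟨e⟩

/-- **H7 (M; PROVED here from H7a and tree lemmas).**  ONE irreducible realisation `ρ_g` of the
`Γ₀(N)`-newform `f₀` at `p'` (attached away from `N p'`) and `a_q(f₀) = a_q(W)` off a finite set
`T₀` give, at every place `v` with `q_v ∤ N p'`: `W` has good reduction at `v` AND
`a_{q_v}(f₀) = a_{q_v}(W)` — NO Carayol input.  Route: frame `V_{p'}W`
(`exists_framedGaloisRep_rationalTate`); `ρ_g ≅ V_{p'}W ⊗ ℚ̄_{p'}` (H7a); `ρ_g` unramified at `v`,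
transported (`isUnramifiedAt_of_equiv`) and descended (`isUnramifiedAt_baseChange_iff`), read on
`V_{p'}W` through the frame; Néron–Ogg–Shafarevich
(`hasGoodReductionAt_iff_forall_rationalGaloisRepTate_eq_one neronOggShafarevich_holds`, `v ∤ p'`);
then the frame's Frobenius polynomial `X² - a_{q_v}(W) X + q_v` base-changed
(`hasFrobCharpolyAt_baseChange`) against the transported Hecke polynomial
(`hasFrobCharpolyAt_of_equiv`) at one arithmetic Frobenius, `X`-coefficients.
[cite: SilvermanAEC2009, Thm. VII.7.1] [cite: DeligneSerreASENS1974, Thm. 6.1 (6.1.1)] -/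
theorem hasGoodReductionAt_and_cuspCoeff_eq_of_realisation
    (W : WeierstrassCurve ℚ) [W.IsElliptic] {N : ℕ} [NeZero N] (f₀ : CuspForm (Gamma0 N) 2)
    (hf₀ : IsNewform0 f₀) {T₀ : ℕ} (hT₀ : T₀ ≠ 0)
    (hfp : ∀ p : ℕ, p.Prime → ¬ p ∣ T₀ → cuspCoeff f₀ p = (W.LFunction p : ℂ))
    (p' : ℕ) [Fact p'.Prime] (ι : PadicAlgCl p' ≃+* ℂ) (ρg : FramedGaloisRep ℚ (PadicAlgCl p') 2)
    (hρg : IsGaloisRepOfNewform1 (liftToGamma1 N 2 f₀)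
      ((ι.symm : ℂ →+* PadicAlgCl p').comp (algebraMap (coeffCharField (liftToGamma1 N 2 f₀)) ℂ))
      {q | q ∣ N * p'} ρg)
    (hirr : ρg.toGaloisRep.IsIrreducible)
    (v : HeightOneSpectrum (𝓞 ℚ)) (hv : ¬ ((primesEquiv v : ℕ) ∣ N * p')) :
    W.HasGoodReductionAt v ∧
      cuspCoeff f₀ (primesEquiv v : ℕ) = (W.LFunction (primesEquiv v : ℕ) : ℂ) := by
  classical
  have hp' : p'.Prime := Fact.out
  have hvp' : (primesEquiv v : ℕ) ≠ p' := fun h ↦ hv (by rw [h]; exact dvd_mul_left p' N)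
  have hp'v : (p' : 𝓞 ℚ) ∉ v.asIdeal :=
    WeierstrassCurve.natCast_not_mem_asIdeal_of_primesEquiv_ne hp' hvp'
  -- the frame of `V_{p'} W` and the equivalence `ρ_g ≅ V_{p'} W ⊗ ℚ̄_{p'}`
  obtain ⟨VQ, eV, heV, hV⟩ := exists_framedGaloisRep_rationalTate W p'
  obtain ⟨e⟩ := H2'_equiv_of_isGaloisRepOfNewform1 W f₀ hf₀ hT₀ hfp p' ι VQ hV ρg hρg hirr
  -- `ρ_g`'s local data at `v ∤ N p'`, transported along `e`
  obtain ⟨hurg, hchg⟩ := hρg v hv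
  have hurB := FramedGaloisRep.isUnramifiedAt_of_equiv e hurg
  have hchB := FramedGaloisRep.hasFrobCharpolyAt_of_equiv e hchg
  -- descend unramifiedness to the frame and read good reduction (Néron–Ogg–Shafarevich)
  have hurV : FramedGaloisRep.IsUnramifiedAt v VQ :=
    (FramedGaloisRep.isUnramifiedAt_baseChange_iff (algebraMap ℚ_[p'] (PadicAlgCl p'))
      (continuous_algebraMap_padicAlgCl p') (algebraMap ℚ_[p'] (PadicAlgCl p')).injective v VQ).mp
      hurB
  have hgood : W.HasGoodReductionAt v := by
    refine (W.hasGoodReductionAt_iff_forall_rationalGaloisRepTate_eq_one p'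
      W.neronOggShafarevich_holds hp'v).mpr ?_
    intro 𝔓 h𝔓 τ hτ
    have h1 : VQ τ = 1 := hurV 𝔓 h𝔓 τ hτ
    refine LinearMap.ext fun y ↦ ?_
    obtain ⟨x, rfl⟩ := eV.surjective y
    rw [← heV τ x, FramedRep.toRepresentation_apply_apply, h1]
    simp
  refine ⟨hgood, ?_⟩
  -- the frame's Frobenius polynomial at `v` (good reduction), base-changed, at one Frobenius
  obtain ⟨-, hchV⟩ := hV v hp'v hgood
  have hchVB := FramedGaloisRep.hasFrobCharpolyAt_baseChange (algebraMap ℚ_[p'] (PadicAlgCl p'))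
    (continuous_algebraMap_padicAlgCl p') hchV
  obtain ⟨𝔓, h𝔓⟩ := primesAbove_nonempty v
  obtain ⟨σ, hσ⟩ := exists_isArithFrobAt_of_mem_primesAbove_holds (v := v) h𝔓
  have hPQ := (hchVB 𝔓 h𝔓 σ hσ).symm.trans (hchB 𝔓 h𝔓 σ hσ)
  rw [← Polynomial.map_map, map_heckePolynomial, coe_liftToGamma1_holds N 2 f₀] at hPQ
  simp only [Polynomial.map_sub, Polynomial.map_add, Polynomial.map_mul, Polynomial.map_pow,
    Polynomial.map_X, Polynomial.map_C] at hPQ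
  have hc := congrArg (fun P : Polynomial (PadicAlgCl p') ↦ P.coeff 1) hPQ
  simp only [coeff_one_X_sq_sub_C_mul_X_add_C', neg_inj] at hc
  have hc' := congrArg (⇑ι) hc
  simp only [map_intCast, RingHom.coe_coe, RingEquiv.apply_symm_apply] at hc'
  rw [cuspCoeff]
  exact hc'.symm

/-! ## §3 NEW (gen 7): the seam `R(p₁) ∧ R(p₂) → SomeLevelPacket`, PROVED from H7 -/

/-- **Seam (PROVED from H7).**  Two realisations at distinct FIXED primes fill the `ℓ`-hole of the
hypothesis `W.IsModularGaloisRepTate ℓ`: the rational newform of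
`exists_rational_isNewform0_of_isModularGaloisRepTate'` carries `a_p(W)` at EVERY `p ∤ N` and `W` is
good off `N` — at a place `v ∤ N` use the realisation at whichever of `p₁, p₂` is not `q_v`. -/
theorem someLevelPacket_of_two_realisations {p₁ p₂ : ℕ} [Fact p₁.Prime] [Fact p₂.Prime]
    (hne : p₁ ≠ p₂) (h₁ : RealisationAt p₁) (h₂ : RealisationAt p₂) : SomeLevelPacket := by
  classical
  intro W _ ℓ _ h
  have hℓ : ℓ.Prime := Fact.out
  have hp₁ : p₁.Prime := Fact.out
  have hp₂ : p₂.Prime := Fact.out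
  obtain ⟨N, hN, f₀, hf₀, hrat, hfp⟩ := exists_rational_isNewform0_of_isModularGaloisRepTate' W ℓ h
  have hT₀ : N * (ℓ * W.conductorNorm ℤ) ≠ 0 :=
    mul_ne_zero (NeZero.ne N) (mul_ne_zero hℓ.ne_zero W.conductorNorm_pos_holds.ne')
  obtain ⟨ι₁⟩ := PadicAlgCl.nonempty_ringEquiv_complex p₁
  obtain ⟨ι₂⟩ := PadicAlgCl.nonempty_ringEquiv_complex p₂
  obtain ⟨ρ₁, hρ₁, hirr₁⟩ := h₁ f₀ hf₀ hrat ι₁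
  obtain ⟨ρ₂, hρ₂, hirr₂⟩ := h₂ f₀ hf₀ hrat ι₂
  -- at every place `v ∤ N`: good reduction and `a_{q_v}(f₀) = a_{q_v}(W)`
  have key : ∀ v : HeightOneSpectrum (𝓞 ℚ), ¬ ((primesEquiv v : ℕ) ∣ N) →
      W.HasGoodReductionAt v ∧
        cuspCoeff f₀ (primesEquiv v : ℕ) = (W.LFunction (primesEquiv v : ℕ) : ℂ) := by
    intro v hvN
    have hq : (primesEquiv v : ℕ).Prime := (primesEquiv v).2
    by_cases hq₁ : (primesEquiv v : ℕ) = p₁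
    · refine hasGoodReductionAt_and_cuspCoeff_eq_of_realisation W f₀ hf₀ hT₀ hfp p₂ ι₂ ρ₂ hρ₂ hirr₂
        v fun hdvd ↦ ?_
      rcases (Nat.Prime.dvd_mul hq).mp hdvd with h' | h'
      · exact hvN h'
      · exact hne (hq₁ ▸ ((Nat.prime_dvd_prime_iff_eq hq hp₂).mp h'))
    · refine hasGoodReductionAt_and_cuspCoeff_eq_of_realisation W f₀ hf₀ hT₀ hfp p₁ ι₁ ρ₁ hρ₁ hirr₁
        v fun hdvd ↦ ?_
      rcases (Nat.Prime.dvd_mul hq).mp hdvd with h' | h'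
      · exact hvN h'
      · exact hq₁ ((Nat.prime_dvd_prime_iff_eq hq hp₁).mp h')
  refine ⟨N, hN, f₀, hf₀, fun v hv ↦ (key v hv).1, fun p hp hpN ↦ ?_⟩
  have hpv : (primesEquiv ((primesEquiv (R := 𝓞 ℚ)).symm ⟨p, hp⟩) : ℕ) = p := by
    rw [Equiv.apply_symm_apply]
  have k2 := (key ((primesEquiv (R := 𝓞 ℚ)).symm ⟨p, hp⟩) (by rw [hpv]; exact hpN)).2
  rwa [hpv] at k2

/-- **`J(3) ∧ J(5) → SomeLevelPacket`** (PROVED from H7 via H3): the k1 leaves feed the k2 closer. -/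
theorem someLevelPacket_of_jacobianLeaf_three_five
    (h3 : @JacobianLeafAt 3 ⟨Nat.prime_three⟩) (h5 : @JacobianLeafAt 5 ⟨by norm_num⟩) :
    SomeLevelPacket :=
  haveI : Fact (Nat.Prime 3) := ⟨Nat.prime_three⟩
  haveI : Fact (Nat.Prime 5) := ⟨by norm_num⟩
  someLevelPacket_of_two_realisations (p₁ := 3) (p₂ := 5) (by decide)
    (realisationAt_of_jacobianLeafAt h3) (realisationAt_of_jacobianLeafAt h5)

/-! ## §4 Closers -/

/-- **The k2 packet closer, BY NAME.**  The type of k2 g6's PROVED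
`stub_threeImpTwo_of_packet_leaves` composed with its PROVED
`steinbergSignPacket_of_newform0SteinbergCoinvariants` (`STUB_IDEAS_stub_threeImpTwo_2g6_Sketch.lean`
:1456, :1114; farm rc 0, 0 sorries, 2026-08-31).  A hypothesis here ONLY because crux-dir companions
are not importable modules; the stub prover transcribes those two proofs (≈ 60 lines + their ported
M1/M3/H4 blocks) or lands them as a Theorems helper. -/
def PacketLeavesCloser : Prop :=
  SomeLevelPacket → Carayol1986_artinConductorExponent →
    (∀ (V : WeierstrassCurve ℚ) (ℓ : ℕ) [Fact ℓ.Prime],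
      V.swanConductorAt_rationalTate_eq_wildConductorExponent_of_ringChar_eq_two ℓ) →
    Newform0SteinbergCoinvariants → SigS9

/-- **Gen-7 merged closer (PROVED modulo H7 and the named k2 closer): the VERBATIM stub from the
minimal leaf set {`J(3)`, `J(5)`, Carayol (A), Saito-at-2 ∀ curves, Steinberg corner}.** -/
theorem sigS9_of_minimal_leaves (hK2 : PacketLeavesCloser)
    (h3 : @JacobianLeafAt 3 ⟨Nat.prime_three⟩) (h5 : @JacobianLeafAt 5 ⟨by norm_num⟩)
    (hCA : Carayol1986_artinConductorExponent)
    (hS : ∀ (V : WeierstrassCurve ℚ) (ℓ : ℕ) [Fact ℓ.Prime],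
      V.swanConductorAt_rationalTate_eq_wildConductorExponent_of_ringChar_eq_two ℓ)
    (hSt : Newform0SteinbergCoinvariants) : SigS9 :=
  hK2 (someLevelPacket_of_jacobianLeaf_three_five h3 h5) hCA hS hSt

/-- The verbatim stub, as the skeleton states it, from the same five leaves + the named k2 closer. -/
theorem stub_threeImpTwo_of_minimal_leaves (hK2 : PacketLeavesCloser)
    (h3 : @JacobianLeafAt 3 ⟨Nat.prime_three⟩) (h5 : @JacobianLeafAt 5 ⟨by norm_num⟩)
    (hCA : Carayol1986_artinConductorExponent)
    (hS : ∀ (V : WeierstrassCurve ℚ) (ℓ : ℕ) [Fact ℓ.Prime],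
      V.swanConductorAt_rationalTate_eq_wildConductorExponent_of_ringChar_eq_two ℓ)
    (hSt : Newform0SteinbergCoinvariants) :
    ∀ (W : WeierstrassCurve ℚ) [W.IsElliptic] [NeZero (W.conductorNorm ℤ)] (ℓ : ℕ) [Fact ℓ.Prime],
      W.IsModularGaloisRepTate ℓ → BCDT.IsModular W :=
  sigS9_of_minimal_leaves hK2 h3 h5 hCA hS hSt

/-- **Road B (k1 g6's closer re-based on the tree's Aug-28 level theorem)**: the level fact used by
k1 g6 / the tree's `isModular_of_isModularGaloisRepTate_of_two_facts` is itself closed in the tree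
from Carayol (A) + Saito (`IsNewformOf.level_eq_conductorNorm_of_carayol_of_saito'`), so road B's
leaf set is {`J(3)`, `J(5)`, `Carayol1986_eulerFactor`, Carayol (A), Saito ∀V} ⊋ road A's
(`Carayol1986_eulerFactor ⇒ Newform0SteinbergCoinvariants`, k2 g6 :602).  PROVED (tree only). -/
theorem levelFact_of_carayolA_of_saito (hCA : Carayol1986_artinConductorExponent)
    (hS : ∀ (V : WeierstrassCurve ℚ) (ℓ : ℕ) [Fact ℓ.Prime],
      V.swanConductorAt_rationalTate_eq_wildConductorExponent_of_ringChar_eq_two ℓ)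
    (N : ℕ) [NeZero N] : IsNewformOf.level_eq_conductorNorm (N := N) :=
  IsNewformOf.level_eq_conductorNorm_of_carayol_of_saito' hCA hS

end Summit.ABC.ABC.Cruxes.FreyModularity.Sketch.StubIdeasThreeImpTwo1G7

end
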